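import Summits.CriticalPhenomena.CardyFormulaZ2.Theorems.CardyBoundaryCoulombGasHalfPlaneMarkDensityLawWindowLowerBound

/-!
# `HalfPlaneMarkDensityLaw` (crux stmt-CriticalPhenomena-5661), line `Sketch`, lead c12-0, wave 2 assembly, part 2:
# the window bound in the SECOND mark and strict monotonicity in the source arc

Sequel of `…WindowLowerBound.lean`: `dualSeal_right` (trapping with the REVERSED dual walk: a boundary
vertex strictly inside the sealed segment is not joined to any boundary vertex right of it),
`stub_window2_lowerBound` (`P_n(a,b',c,y) − P_n(a,b,c,y) ≥ c₀ > 0` eventually for `a < b < b' < c < y`: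
a dual U around the short source arc `[⌊an⌋,⌊bn⌋]` seals it from the target, an independent primal
arch joins `[⌊b''n⌋,⌊b'n⌋]` to the target), and `stub_jointLimit_strictMono_second`
(`G(a,b,c,y) < G(a,b',c,y)`).  With part 1 (fourth mark) and the reflection symmetry
`G(−y,−c,−b,−a) = G(a,b,c,y)` (`…Symmetry.lean`), every joint subsequential scaling limit of the
half-plane four-arc crossing probability of critical bond-`ℤ²` is strictly monotone in EACH mark.
-/

noncomputable section

namespace Summit.CriticalPhenomena.CardyFormulaZ2.Cruxes.HalfPlaneMarkDensityLaw.SketchLine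

open Literature.Probability.Percolation Literature.Probability.LatticeModels
open MeasureTheory Filter Set SimpleGraph
open scoped Topology
open Summit.CriticalPhenomena.CardyFormulaZ2.Theorems.HalfPlaneMarkDensityLaw.Negative

namespace Window

/-! ### The second mark -/

/-- **Sealing, right side.** With a dual walk as in `stub_dualSeal`, a boundary vertex `u` strictly
inside `(p₁, p₂]` is not joined inside `ℤ×ℕ` to any boundary vertex `v` right of `p₂`
(`SelfDual.moat_end_trapped` applied to the REVERSED dual walk). [folklore] -/
theorem dualSeal_right {ω : BondConfig (Site 2)} (hω : ω ⊆ (zdGraph 2).edgeSet) {p₁ p₂ : ℤ}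
    (hQ : ∃ Q : (zdGraph 2).Walk (![p₁, -1] : Site 2) ![p₂, -1],
      (∀ e ∈ Q.edges, e ∈ dualConfig ω) ∧ (∀ z ∈ Q.support, -1 ≤ z 1) ∧
      (∀ e ∈ Q.edges, ∃ w ∈ e, (0 : ℤ) ≤ w 1))
    {u v : Site 2} (hu : u 1 = 0) (hv : v 1 = 0) (hpu : p₁ < u 0) (hup : u 0 ≤ p₂) (hpv : p₂ < v 0) :
    ω ∉ openConnIn halfPlane u v := by
  intro hconn
  obtain ⟨Q₀, hQω₀, hQS₀, hQ0₀⟩ := hQ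
  set Q := Q₀.reverse with hQdef
  have hQω : ∀ e ∈ Q.edges, e ∈ dualConfig ω := fun e he => hQω₀ e (by
    rw [hQdef, Walk.edges_reverse, List.mem_reverse] at he; exact he)
  have hQS : ∀ z ∈ Q.support, -1 ≤ z 1 := fun z hz => hQS₀ z (by
    rw [hQdef, Walk.support_reverse, List.mem_reverse] at hz; exact hz)
  have hQ0 : ∀ e ∈ Q.edges, ∃ w ∈ e, (0 : ℤ) ≤ w 1 := fun e he => hQ0₀ e (by
    rw [hQdef, Walk.edges_reverse, List.mem_reverse] at he; exact he)
  obtain ⟨P₀, hP₀S, hP₀ω⟩ := exists_walk_of_mem_openConnIn hω hconn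
  have hu' : u = ![u 0, 0] := by ext i; fin_cases i <;> simp [hu]
  have hv' : v = ![v 0, 0] := by ext i; fin_cases i <;> simp [hv]
  set ℓ := u 0 with hℓ
  set r := v 0 with hr
  set P : (zdGraph 2).Walk (![ℓ, 0] : Site 2) ![r, 0] := P₀.copy hu' hv' with hPdef
  have hPS : ∀ z ∈ P.support, 0 ≤ z 1 := by
    intro z hz
    rw [hPdef, Walk.support_copy] at hz
    exact hP₀S z hz
  have hPω : ∀ e ∈ P.edges, e ∈ insert (Z2HalfPlane.leg ℓ) (insert (Z2HalfPlane.leg r) ω) := by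
    intro e he
    rw [hPdef, Walk.edges_copy] at he
    exact Set.mem_insert_of_mem _ (Set.mem_insert_of_mem _ (hP₀ω e he))
  have hQω' : ∀ e ∈ Q.edges,
      e ∈ dualConfig (insert (Z2HalfPlane.leg ℓ) (insert (Z2HalfPlane.leg r) ω)) :=
    fun e he => SelfDual.mem_dualConfig_insert_legs (hQω e he) (hQ0 e he)
  have hleg_ℓ : Z2HalfPlane.leg ℓ ∈ insert (Z2HalfPlane.leg ℓ) (insert (Z2HalfPlane.leg r) ω) :=
    Set.mem_insert _ _
  have hleg_r : Z2HalfPlane.leg r ∈ insert (Z2HalfPlane.leg ℓ) (insert (Z2HalfPlane.leg r) ω) :=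
    Set.mem_insert_of_mem _ (Set.mem_insert _ _)
  have htrap := SelfDual.moat_end_trapped
    (ω := insert (Z2HalfPlane.leg ℓ) (insert (Z2HalfPlane.leg r) ω)) (a := ℓ) (b := p₂) (c := r)
    hup hpv hleg_ℓ hleg_r P hPω hPS Q hQω' hQS (by simp)
  simp only [Matrix.cons_val_zero] at htrap
  omega

/-- **STUB (registered signature): the window bound in the SECOND mark.** For `a < b < b' < c < y`, growing the source arc from
`[⌊an⌋,⌊bn⌋]` to `[⌊an⌋,⌊b'n⌋]` increases `P_n` by at least `c₀ > 0` eventually: a dual U around the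
short arc seals it from the target (`stub_dualU_walk`, `dualSeal_right`), an independent primal arch joins
`[⌊b''n⌋,⌊b'n⌋]` to the target. [folklore] -/
theorem stub_window2_lowerBound :
    ∀ (a b b' c y : ℝ), a < b → b < b' → b' < c → c < y →
      ∃ c₀ : ℝ, 0 < c₀ ∧ ∀ᶠ n : ℕ in atTop,
      c₀ ≤ μ.real (openCrossing halfPlane (arcA a b' n) (rowIcc ⌊c * n⌋ ⌊y * n⌋) \
        openCrossing halfPlane (arcA a b n) (rowIcc ⌊c * n⌋ ⌊y * n⌋)) := by
  intro a b b' c y hab hbb' hb'c hcy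
  classical
  set d : ℝ := (b - a) / 3 with hd
  set g₁ : ℝ := a - 2 * d with hg₁
  set g₂ : ℝ := a - d with hg₂
  set r₂ : ℝ := b + (b' - b) / 3 with hr₂
  set b'' : ℝ := b + 2 * (b' - b) / 3 with hb''
  have hdpos : 0 < d := by rw [hd]; linarith
  have hg₁₂ : g₁ < g₂ := by rw [hg₁, hg₂]; linarith
  have hg₂a : g₂ < a := by rw [hg₂]; linarith
  have hg₂b : g₂ < b := by linarith
  have hbr₂ : b < r₂ := by rw [hr₂]; linarith
  have hr₂b'' : r₂ < b'' := by rw [hr₂, hb'']; linarith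
  have hb''b' : b'' < b' := by rw [hb'']; linarith
  obtain ⟨cU, hcU0, hU⟩ := stub_dualU_prob g₁ g₂ b r₂ (1 / 2) 1 hg₁₂ hg₂b hbr₂ (by norm_num) (by norm_num)
  obtain ⟨cA, hcA0, hA⟩ := stub_primalArch b'' b' c y 1 hb''b' hb'c hcy one_pos
  refine ⟨cU * cA, mul_pos hcU0 hcA0, ?_⟩
  filter_upwards [hU, hA, eventually_floor_add_two_le hg₁₂, eventually_floor_add_two_le hg₂a,
    eventually_floor_add_two_le hab, eventually_floor_add_two_le hbr₂, eventually_floor_add_two_le hr₂b'',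
    eventually_floor_add_two_le hb''b', eventually_floor_add_two_le hb'c, eventually_floor_add_two_le hcy,
    eventually_one_le_floor (one_half_pos : (0:ℝ) < 1 / 2), eventually_one_le_floor (one_pos : (0:ℝ) < 1)]
    with n hUn hAn e1 e2 e3 e4 e5 e6 e7 e8 e9 e10
  set G₁ := ⌊g₁ * n⌋ with hG₁
  set G₂ := ⌊g₂ * n⌋ with hG₂
  set Bf := ⌊b * n⌋ with hBf
  set R₂ := ⌊r₂ * n⌋ with hR₂
  set B'' := ⌊b'' * n⌋ with hB''
  set B' := ⌊b' * n⌋ with hB'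
  set Y := ⌊y * n⌋ with hY
  set Hh := ⌊(1 / 2 : ℝ) * n⌋ with hHh
  set H := ⌊(1 : ℝ) * n⌋ with hH
  have hHhH : Hh ≤ H := Int.floor_le_floor (by nlinarith [(Nat.cast_nonneg n : (0:ℝ) ≤ n)])
  set U : Set (BondConfig (Site 2)) := dualConfig ⁻¹' (
      openCrossing {z : Site 2 | G₁ ≤ z 0 ∧ z 0 ≤ G₂ ∧ -1 ≤ z 1 ∧ z 1 ≤ H} {z : Site 2 | z 1 = -1} {z : Site 2 | z 1 = H} ∩
      openCrossing {z : Site 2 | G₁ ≤ z 0 ∧ z 0 ≤ R₂ ∧ Hh ≤ z 1 ∧ z 1 ≤ H} {z : Site 2 | z 0 = G₁} {z : Site 2 | z 0 = R₂} ∩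
      openCrossing {z : Site 2 | Bf ≤ z 0 ∧ z 0 ≤ R₂ ∧ -1 ≤ z 1 ∧ z 1 ≤ H} {z : Site 2 | z 1 = -1} {z : Site 2 | z 1 = H})
    with hUdef
  set T : Set (Site 2) := {v : Site 2 | B'' ≤ v 0 ∧ v 0 ≤ B' ∧ 0 ≤ v 1 ∧ v 1 ≤ 3 * H} ∪
      {v : Site 2 | B'' ≤ v 0 ∧ v 0 ≤ Y ∧ 2 * H ≤ v 1 ∧ v 1 ≤ 3 * H} ∪
      {v : Site 2 | ⌊c * n⌋ ≤ v 0 ∧ v 0 ≤ Y ∧ 0 ≤ v 1 ∧ v 1 ≤ 3 * H} with hTdef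
  set Ar : Set (BondConfig (Site 2)) := openCrossing T (arcA b'' b' n) (rowIcc ⌊c * n⌋ Y) with hArdef
  -- (1) deterministic inclusion (a.e.)
  have hincl : ∀ᵐ ω ∂μ, ω ∈ U ∩ Ar →
      ω ∈ openCrossing halfPlane (arcA a b' n) (rowIcc ⌊c * n⌋ Y) \ openCrossing halfPlane (arcA a b n) (rowIcc ⌊c * n⌋ Y) := by
    rw [show μ = bondPercolation (zdGraph 2) half from rfl]
    filter_upwards [ae_subset_edgeSet (zdGraph 2) half] with ω hω hωUA
    obtain ⟨hωU, hωA⟩ := hωUA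
    constructor
    · have hTH : T ⊆ halfPlane := by
        rintro v ((⟨-, -, h3, -⟩ | ⟨-, -, h3, -⟩) | ⟨-, -, h3, -⟩)
        · exact h3
        · show (0 : ℤ) ≤ v 1; omega
        · exact h3
      have harc : arcA b'' b' n ⊆ arcA a b' n := fun v ⟨h1, h2, h3⟩ => ⟨h1, by show ⌊a * (n:ℝ)⌋ ≤ v 0; omega, h3⟩
      exact openCrossing_mono hTH harc subset_rfl hωA
    · obtain ⟨⟨hL, hB⟩, hR⟩ := hωU
      obtain ⟨p₁, p₂, hp₁, hp₁', hp₂, hp₂', Q, hQω, hQ1, hQ0⟩ :=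
        stub_dualU_walk ω G₁ G₂ Bf R₂ Hh H (by omega) (by omega) (by omega) (by omega) hHhH hL hB hR
      rintro ⟨u, ⟨hu1, hua, hub⟩, v, ⟨hv1, hvc, -⟩, huv⟩
      exact dualSeal_right hω ⟨Q, hQω, hQ1, hQ0⟩ hu1 hv1 (by show p₁ < u 0; omega) (by show u 0 ≤ p₂; omega)
        (by show p₂ < v 0; omega) huv
  -- (2) independence
  set Φ : Finset (Site 2) := Finset.Icc ![G₁, -1] ![R₂, H] with hΦ
  have hmemΦ : ∀ z : Site 2, z ∈ Φ ↔ G₁ ≤ z 0 ∧ z 0 ≤ R₂ ∧ -1 ≤ z 1 ∧ z 1 ≤ H := by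
    intro z
    simp only [hΦ, Finset.mem_Icc, Pi.le_def, Fin.forall_fin_two, Matrix.cons_val_zero, Matrix.cons_val_one]
    tauto
  have hTfin : T.Finite := by
    refine (Set.finite_Icc (![B'', 0] : Site 2) ![Y, 3 * H]).subset ?_
    intro v hv
    simp only [Set.mem_Icc, Pi.le_def, Fin.forall_fin_two, Matrix.cons_val_zero, Matrix.cons_val_one]
    rcases hv with (⟨h1, h2, h3, h4⟩ | ⟨h1, h2, h3, h4⟩) | ⟨h1, h2, h3, h4⟩ <;> refine ⟨⟨?_, ?_⟩, ?_, ?_⟩ <;> omega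
  have hbox : ∀ (S : Set (Site 2)) (hS : S.Finite) (A B : Set (Site 2)), S ⊆ ↑Φ →
      DeterminedBy (openCrossing S A B) (↑Φ.sym2 : Set (Sym2 (Site 2))) := by
    intro S hS A B hSΦ
    refine (Indep.determinedBy_openCrossing_finite hS A B).mono ?_
    intro e he
    rw [Finset.mem_coe, Finset.mem_sym2_iff] at he ⊢
    intro w hw
    exact hSΦ (by simpa using he w hw)
  have hdetU : DeterminedBy U (dualEdge ⁻¹' (↑Φ.sym2 : Set (Sym2 (Site 2)))) := by
    rw [hUdef]
    refine DeterminedBy.preimage_dualConfig (((hbox _ ?_ _ _ ?_).inter (hbox _ ?_ _ _ ?_)).inter (hbox _ ?_ _ _ ?_))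
    · exact (Set.finite_Icc (![G₁, -1] : Site 2) ![G₂, H]).subset fun z ⟨h1, h2, h3, h4⟩ => by
        simp only [Set.mem_Icc, Pi.le_def, Fin.forall_fin_two, Matrix.cons_val_zero, Matrix.cons_val_one]; omega
    · intro z ⟨h1, h2, h3, h4⟩; rw [Finset.mem_coe, hmemΦ]; omega
    · exact (Set.finite_Icc (![G₁, Hh] : Site 2) ![R₂, H]).subset fun z ⟨h1, h2, h3, h4⟩ => by
        simp only [Set.mem_Icc, Pi.le_def, Fin.forall_fin_two, Matrix.cons_val_zero, Matrix.cons_val_one]; omega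
    · intro z ⟨h1, h2, h3, h4⟩; rw [Finset.mem_coe, hmemΦ]; omega
    · exact (Set.finite_Icc (![Bf, -1] : Site 2) ![R₂, H]).subset fun z ⟨h1, h2, h3, h4⟩ => by
        simp only [Set.mem_Icc, Pi.le_def, Fin.forall_fin_two, Matrix.cons_val_zero, Matrix.cons_val_one]; omega
    · intro z ⟨h1, h2, h3, h4⟩; rw [Finset.mem_coe, hmemΦ]; omega
  have hdetA : DeterminedBy Ar (↑hTfin.toFinset.sym2 : Set (Sym2 (Site 2))) :=
    Indep.determinedBy_openCrossing_finite hTfin _ _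
  have hdisj : Disjoint (dualEdge ⁻¹' (↑Φ.sym2 : Set (Sym2 (Site 2)))) (↑hTfin.toFinset.sym2 : Set (Sym2 (Site 2))) := by
    refine Set.disjoint_left.2 fun e heΦ heT => ?_
    rw [mem_preimage, Finset.mem_coe, Finset.mem_sym2_iff] at heΦ
    rw [Finset.mem_coe, Finset.mem_sym2_iff] at heT
    obtain ⟨w, hwd, hwe⟩ := stub_dualEdge_shares e
    have hwΦ := (hmemΦ w).1 (heΦ w hwd)
    have hwT : w ∈ T := by simpa using heT w hwe
    rcases hwT with (⟨h1, h2, h3, h4⟩ | ⟨h1, h2, h3, h4⟩) | ⟨h1, h2, h3, h4⟩ <;> omega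
  have hUm : MeasurableSet U :=
    measurable_dualConfig (((measurableSet_openCrossing_of_countable _ _ _).inter
      (measurableSet_openCrossing_of_countable _ _ _)).inter (measurableSet_openCrossing_of_countable _ _ _))
  have hAm : MeasurableSet Ar := measurableSet_openCrossing_of_countable _ _ _
  have hind : μ.real (U ∩ Ar) = μ.real U * μ.real Ar :=
    bondPercolation_real_inter_of_disjoint (zdGraph 2) half hdisj hdetU hdetA hUm hAm
  calc cU * cA ≤ μ.real U * μ.real Ar := mul_le_mul hUn hAn hcA0.le measureReal_nonneg
    _ = μ.real (U ∩ Ar) := hind.symm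
    _ ≤ _ := by
        rw [measureReal_def, measureReal_def]
        exact ENNReal.toReal_mono (measure_ne_top _ _) (measure_mono_ae hincl)

/-- **STUB (registered signature): joint subsequential limits are STRICTLY increasing in the second mark**: `G(a,b,c,y) < G(a,b',c,y)`
for `b < b'`. [folklore] -/
theorem stub_jointLimit_strictMono_second :
    ∀ {θ : ℕ → ℕ} {G : ℝ → ℝ → ℝ → ℝ → ℝ},
      (∀ a b c y : ℝ, a < b → b < c → c < y →
        Tendsto (fun n ↦ μ.real (openCrossing halfPlane (arcA a b (θ n))
          (rowIcc ⌊c * (θ n : ℕ)⌋ ⌊y * (θ n : ℕ)⌋))) atTop (𝓝 (G a b c y))) →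
      StrictMono θ → ∀ {a b b' c y : ℝ}, a < b → b < b' → b' < c → c < y → G a b c y < G a b' c y := by
  intro θ G hG hθ a b b' c y hab hbb' hb'c hcy
  obtain ⟨c₀, hc₀, hev⟩ := stub_window2_lowerBound a b b' c y hab hbb' hb'c hcy
  have hdiff : ∀ n : ℕ, μ.real (openCrossing halfPlane (arcA a b' n) (rowIcc ⌊c * n⌋ ⌊y * n⌋) \
        openCrossing halfPlane (arcA a b n) (rowIcc ⌊c * n⌋ ⌊y * n⌋)) =
      μ.real (openCrossing halfPlane (arcA a b' n) (rowIcc ⌊c * n⌋ ⌊y * n⌋)) -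
        μ.real (openCrossing halfPlane (arcA a b n) (rowIcc ⌊c * n⌋ ⌊y * n⌋)) := by
    intro n
    refine measureReal_sdiff ?_ (measurableSet_openCrossing_of_countable _ _ _)
    refine openCrossing_mono subset_rfl (fun v ⟨h1, h2, h3⟩ => ⟨h1, h2, h3.trans ?_⟩) subset_rfl
    exact Int.floor_le_floor (by nlinarith [(Nat.cast_nonneg n : (0:ℝ) ≤ n)])
  have hlim : Tendsto (fun n ↦ μ.real (openCrossing halfPlane (arcA a b' (θ n)) (rowIcc ⌊c * (θ n : ℕ)⌋ ⌊y * (θ n : ℕ)⌋)) -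
      μ.real (openCrossing halfPlane (arcA a b (θ n)) (rowIcc ⌊c * (θ n : ℕ)⌋ ⌊y * (θ n : ℕ)⌋))) atTop
      (𝓝 (G a b' c y - G a b c y)) :=
    (hG a b' c y (hab.trans hbb') hb'c hcy).sub (hG a b c y hab (hbb'.trans hb'c) hcy)
  have hge : c₀ ≤ G a b' c y - G a b c y := by
    refine ge_of_tendsto hlim ?_
    filter_upwards [hθ.tendsto_atTop.eventually hev] with n hn
    rw [← hdiff (θ n)]
    exact hn
  linarith

end Window

end Summit.CriticalPhenomena.CardyFormulaZ2.Cruxes.HalfPlaneMarkDensityLaw.SketchLine
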